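import Summits.ResolutionOfSingularities.ResolutionOfSingularities.Theorems.HilbertSamuelEliminationSigmaMaxModificationsCorridor3TameWildDefs
import Literature.AlgebraicGeometry.Resolution.HilbertSamuelValues
import Mathlib.AlgebraicGeometry.Morphisms.FiniteType
import Mathlib.AlgebraicGeometry.Noetherian
import Mathlib.FieldTheory.Perfect
import HarnessLib

/-!
# `SigmaMaxModificationsCorridor3` (stmt-ResolutionOfSingularities-19249), line `tame_wild`:
# normalisation of tame values and the stub `stub_tameNu3` at `p = 2` (vacuous)

[OURS · L1 W4.2] For the registered transfer stub `TameWild.stub_tameNu3` (`ν`-modification of a `p`-tame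
non-isolated maximal Hilbert–Samuel stratum of a threefold; `IsTameValue p ν := ∃ m < p, ν = hypersurfaceHF m`):

* `hypersurfaceHF_zero` (`= 0`), `hypersurfaceHF_one` (`= Φ^{(3)}`, the regular value: `C(n+3,3) - C(n+2,3)
  = C(n+2,2)`), `hsFun_apply_zero` (`H^N_X(x)(0) = 1`), hence `two_le_of_isTameValue_of_mem_hsValues`:
  a tame VALUE of `Σ_Y(3)` other than `Φ^{(3)}` has multiplicity `2 ≤ m < p` — the normalisation `2 ≤ m`
  assumed by helper H1 of CRUX-PLAN v1 (`stub_H1_hypersurface_of_hilbertFun`);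
* `not_isTameValue_two`: for `p = 2` no value `≠ Φ^{(3)}` is tame, so `tameNu3_two` — the registered
  `stub_tameNu3` SPECIALISED TO `p = 2` — holds vacuously (CJS Rem. 6.29: in characteristic `2` every
  singular stratum is wild; the whole of `Corridor3@3` at `p = 2` is `stub_isolatedNu3 ∧ stub_wildNu3`).

NOT a statement of any manuscript. [cite: CossartJannsenSaito2020, Def. 2.28, Rem. 6.29]
-/

set_option linter.dupNamespace false -- mandated namespace of this single-conjunct summit

noncomputable section

open CategoryTheory AlgebraicGeometry TopologicalSpace Topology
open Literature.AlgebraicGeometry.Resolution Literature.RingTheory.HilbertSamuel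

namespace Summit.ResolutionOfSingularities.ResolutionOfSingularities.Theorems.SigmaMaxModificationsCorridor3.TameWild

/-- `hypersurfaceHF 0 = 0`: "multiplicity `0`" is the unit ideal, the empty hypersurface. [folklore] -/
theorem hypersurfaceHF_zero : hypersurfaceHF 0 = 0 := by
  funext n
  simp [hypersurfaceHF]

/-- `hypersurfaceHF 1 = Φ^{(3)}`: a hypersurface of multiplicity `1` in a regular fourfold is regular of
dimension `3`, with Hilbert–Samuel value `n ↦ C(n+2, 2)` (`C(n+3,3) - C(n+2,3) = C(n+2,2)`, Pascal).
[cite: CossartJannsenSaito2020, Def. 2.13, Def. 2.28] -/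
theorem hypersurfaceHF_one : hypersurfaceHF 1 = iterPSum 3 Phi := by
  funext n
  have h : (n + 3).choose 3 = (n + 2).choose 2 + (n + 2).choose 3 := Nat.choose_succ_succ' (n + 2) 2
  have h1 : hypersurfaceHF 1 n = (n + 3).choose 3 - (n + 2).choose 3 := rfl
  rw [h1, iterPSum_succ_Phi_eq_choose 2 n]
  omega

/-- `H^N_X(x)(0) = 1` for every point of a locally Noetherian scheme (`H^{(t)}(0) = H^{(0)}(0) =
dim_κ κ = 1`). [cite: CossartJannsenSaito2020, §2.2 (p. 27), Def. 2.28] -/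
theorem hsFun_apply_zero {X : Scheme.{0}} [IsLocallyNoetherian X] (N : ℕ) (x : X) :
    Scheme.hsFun X N x 0 = 1 := by
  rw [Scheme.hsFun_def, hilbertSamuelFun, iterPSum_apply_zero, hilbertFun_zero]

/-- A Hilbert–Samuel VALUE is never the zero function. [folklore] -/
theorem ne_zero_of_mem_hsValues {X : Scheme.{0}} [IsLocallyNoetherian X] {N : ℕ} {ν : ℕ → ℕ}
    (hν : ν ∈ Scheme.hsValues X N) : ν ≠ 0 := by
  obtain ⟨x, rfl⟩ := hν
  intro h
  have h0 := congrFun h 0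
  rw [hsFun_apply_zero] at h0
  exact one_ne_zero h0

/-- **Normalisation of tame values:** a `p`-tame value of `Σ_X(3)` other than the regular value `Φ^{(3)}`
is `hypersurfaceHF m` with `2 ≤ m < p`. [cite: CossartJannsenSaito2020, Def. 2.28, Lemma 2.23] -/
theorem two_le_of_isTameValue_of_mem_hsValues {X : Scheme.{0}} [IsLocallyNoetherian X] {p : ℕ}
    {ν : ℕ → ℕ} (hν : ν ∈ Scheme.hsValues X 3) (hνΦ : ν ≠ iterPSum 3 Phi) (ht : IsTameValue p ν) :
    ∃ m : ℕ, 2 ≤ m ∧ m < p ∧ ν = hypersurfaceHF m := by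
  obtain ⟨m, hmp, rfl⟩ := ht
  refine ⟨m, ?_, hmp, rfl⟩
  by_contra hm
  interval_cases m
  · exact ne_zero_of_mem_hsValues hν hypersurfaceHF_zero
  · exact hνΦ hypersurfaceHF_one

/-- **In characteristic `2` no value `≠ Φ^{(3)}` of `Σ_X(3)` is tame** (`m < 2` leaves the unit ideal and
the regular value). [cite: CossartJannsenSaito2020, Rem. 6.29] -/
theorem not_isTameValue_two {X : Scheme.{0}} [IsLocallyNoetherian X] {ν : ℕ → ℕ}
    (hν : ν ∈ Scheme.hsValues X 3) (hνΦ : ν ≠ iterPSum 3 Phi) : ¬ IsTameValue 2 ν := by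
  intro ht
  obtain ⟨m, h2, hm2, -⟩ := two_le_of_isTameValue_of_mem_hsValues hν hνΦ ht
  omega

/-- More generally no value `≠ Φ^{(3)}` is `p`-tame for `p ≤ 2`. [folklore] -/
theorem not_isTameValue_of_le_two {X : Scheme.{0}} [IsLocallyNoetherian X] {p : ℕ} (hp : p ≤ 2)
    {ν : ℕ → ℕ} (hν : ν ∈ Scheme.hsValues X 3) (hνΦ : ν ≠ iterPSum 3 Phi) : ¬ IsTameValue p ν := by
  intro ht
  obtain ⟨m, h2, hmp, -⟩ := two_le_of_isTameValue_of_mem_hsValues hν hνΦ ht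
  omega

/-- **The registered stub `stub_tameNu3` at `p = 2` (vacuously):** in characteristic `2` the tame regime
of line `tame_wild` is empty, so its `ν`-modification statement holds with nothing to construct; all of
`Corridor3@3` at `p = 2` lies in `stub_isolatedNu3 ∧ stub_wildNu3`.
[cite: CossartJannsenSaito2020, Rem. 6.29, Def. 6.14] -/
theorem tameNu3_two :
    ∀ (k : Type) [Field k] [CharP k 2] [PerfectField k] (Y : Scheme.{0})
      (g : Y ⟶ Spec (.of k)), IsSeparated g → LocallyOfFiniteType g → QuasiCompact g →
      IsReduced Y → ((3 : ℕ) : WithBot ℕ∞) ≤ topologicalKrullDim Y →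
      topologicalKrullDim Y ≤ ((3 : ℕ) : WithBot ℕ∞) →
      ∀ ν : ℕ → ℕ, Maximal (· ∈ Scheme.hsValues Y 3) ν → ν ≠ iterPSum 3 Phi →
        IsTameValue 2 ν →
        ¬ Disjoint (closure ((Scheme.regularLocus Y)ᶜ \ Scheme.hsStratum Y 3 ν))
            (Scheme.hsStratum Y 3 ν) →
        NuMod Y 3 3 ν := by
  intro k _ _ _ Y g _ hft _ _ _ _ ν hν hνΦ ht _
  haveI : IsLocallyNoetherian Y := LocallyOfFiniteType.isLocallyNoetherian g
  exact absurd ht (not_isTameValue_two hν.prop hνΦ)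

/-- **`stub_tameNu3` for every prime `p ≤ 2`** (the same vacuity, in the registered quantifier shape
restricted by the side condition `p ≤ 2`). [cite: CossartJannsenSaito2020, Rem. 6.29] -/
theorem tameNu3_of_prime_le_two :
    ∀ p : ℕ, p.Prime → p ≤ 2 → ∀ (k : Type) [Field k] [CharP k p] [PerfectField k] (Y : Scheme.{0})
      (g : Y ⟶ Spec (.of k)), IsSeparated g → LocallyOfFiniteType g → QuasiCompact g →
      IsReduced Y → ((3 : ℕ) : WithBot ℕ∞) ≤ topologicalKrullDim Y →
      topologicalKrullDim Y ≤ ((3 : ℕ) : WithBot ℕ∞) →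
      ∀ ν : ℕ → ℕ, Maximal (· ∈ Scheme.hsValues Y 3) ν → ν ≠ iterPSum 3 Phi →
        IsTameValue p ν →
        ¬ Disjoint (closure ((Scheme.regularLocus Y)ᶜ \ Scheme.hsStratum Y 3 ν))
            (Scheme.hsStratum Y 3 ν) →
        NuMod Y 3 3 ν := by
  intro p _ hp2 k _ _ _ Y g _ hft _ _ _ _ ν hν hνΦ ht _
  haveI : IsLocallyNoetherian Y := LocallyOfFiniteType.isLocallyNoetherian g
  exact absurd ht (not_isTameValue_of_le_two hp2 hν.prop hνΦ)

end Summit.ResolutionOfSingularities.ResolutionOfSingularities.Theorems.SigmaMaxModificationsCorridor3.TameWild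

end
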